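import Mathlib
import HarnessLib
import Summits.HubbardSuperconductivity.HubbardSuperconductivity.Theorems.KLProgrammeKLRegimeWickDressedFlowLines
import Summits.HubbardSuperconductivity.HubbardSuperconductivity.Theorems.KLProgrammeKLRegimeWickScaleFlowC1

/-!
# Route `KLProgramme` — crux K3, ENGINE child (stmt-HubbardSuperconductivity-20236 / gen-7-flow successor), stub `stub_engine_step_values`, conjunct
# (E2-v10)/(E2-F): the dressed partial-slice family is `C²` in the scale — the `(C, C′, C″)` input of `klws_pairKernel_flowData_of_covCurve`

Cell gate-hubbard-kl, seat hubbard-kl-p1 (g10; (E2) Wick-toolkit lane).  Sequel of `…WickDressedFlowLines` (p523315: the dressed family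
`Λ ↦ normalCovariance (s_Λ/(1 + s_Λκ))` and its FIRST scale derivative).  k3c1-p1's generic flow-data theorem for the continuous (E2) organisation,
`klws_pairKernel_flowData_of_covCurve` (p524128), takes a covariance curve with entrywise `HasDerivAt` for `C` AND for `C′` (i.e. `C″`); by the division
of labour (KL STATUS 10:35:54Z / 10:38:18Z) this file supplies it for the dressed family, in the `deriv`/`deriv ∘ deriv` form, on the OPEN scale set
`U = {Λ ≠ 0} ∩ {∀ (k,σ), 1 + s_Λ(k,σ)κ(k,σ) ≠ 0}`:

* `klws_contDiffOn_sliceSymbol` — the partial-slice symbol `s_Λ(k,σ) = (w^K_Λ − w^K_{Λ₀})(k)·βL²(iω+e_K)/nambuDen` is `C^∞` in `Λ ≠ 0`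
  (`klws_contDiffOn_cutoffWeight_scale`);
* `klws_contDiffOn_dressedSymbol` — `Λ ↦ s_Λ/(1 + s_Λκ)` is `C^∞` where in addition `1 + s_Λκ ≠ 0`;
* `klws_isOpen_dressedScaleSet` — `U` is open; `klws_contDiffOn_dressedSliceCov_apply` — every entry of the dressed family is `C^∞` on `U`;
* **`klws_hasDerivAt_dressedSliceCov_of_mem`** / **`klws_hasDerivAt_deriv_dressedSliceCov_of_mem`** — at every `Λ ∈ U`, the entry and its `deriv`
  have derivatives `deriv …` / `deriv (deriv …)`: the `hC`/`hC'` hypotheses of `klws_pairKernel_flowData_of_covCurve` for the dressed curve (the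
  affine reparametrisation to `Icc 0 1` is k3c1-p1's `klws_hasDerivAt_affine` step, unchanged).

The `Z ≠ 0` hypothesis along the dressed curve reduces to the UNDRESSED partition function by the factorisation
`Z_C(V′ + 𝒩_κ) = Z_C(𝒩_κ)·Z_{C̃}(V′)` (`effPartitionFn_normalCovariance_add_diagQuadratic`, appended to
`Literature/…/HubbardDiagonalQuadraticResummation`).  Exact calculus; nothing about sizes or superconductivity is asserted.  0 kit.
-/

noncomputable section

namespace Summit.HubbardSuperconductivity.HubbardSuperconductivity.Theorems.KLRegimeWick

set_option linter.dupNamespace false -- summit = problem name (single-conjunct summit), D-0017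

open Literature.MathematicalPhysics.QuantumLattice GrassmannAlgebra Finset Matrix Set
open Literature.Probability.LatticeModels

section Model

variable (L M : ℕ) [NeZero L] (β μ : ℝ) (K : TrigPolyC4v)

omit [NeZero L] in
/-- **The partial-slice symbol is smooth in the scale away from `Λ = 0`.** -/
theorem klws_contDiffOn_sliceSymbol {n : ℕ∞} (Λ₀ : ℝ) (ks : FreqMomentum L M × Fin 2) :
    ContDiffOn ℝ n (fun Λ : ℝ =>
      ((hubbardCutoffWeightCT L M β μ K Λ ks.1 : ℂ) - (hubbardCutoffWeightCT L M β μ K Λ₀ ks.1 : ℂ)) *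
        (((β * (L : ℝ) ^ 2 : ℝ) : ℂ) * ((Complex.I * matsubaraFreq β M ks.1.1 + nambuXiCT L μ K ks.1.2) / nambuDenCT L M β μ 0 K ks.1)))
      {Λ : ℝ | Λ ≠ 0} := by
  have hw : ContDiffOn ℝ n (fun Λ : ℝ => ((hubbardCutoffWeightCT L M β μ K Λ ks.1 : ℝ) : ℂ)) {Λ : ℝ | Λ ≠ 0} :=
    Complex.ofRealCLM.contDiff.comp_contDiffOn (klws_contDiffOn_cutoffWeight_scale L M β μ K ks.1)
  exact (hw.sub contDiffOn_const).mul contDiffOn_const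

omit [NeZero L] in
/-- **The dressed symbol `s_Λ/(1 + s_Λκ)` is smooth** on any scale set avoiding `Λ = 0` and the zeros of `1 + s_Λκ`. -/
theorem klws_contDiffOn_dressedSymbol {n : ℕ∞} (Λ₀ : ℝ) (κ : FreqMomentum L M × Fin 2 → ℂ) (ks : FreqMomentum L M × Fin 2)
    {S : Set ℝ} (hS0 : ∀ Λ ∈ S, Λ ≠ 0)
    (hden : ∀ Λ ∈ S, 1 + ((hubbardCutoffWeightCT L M β μ K Λ ks.1 : ℂ) - (hubbardCutoffWeightCT L M β μ K Λ₀ ks.1 : ℂ)) *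
          (((β * (L : ℝ) ^ 2 : ℝ) : ℂ) * ((Complex.I * matsubaraFreq β M ks.1.1 + nambuXiCT L μ K ks.1.2) / nambuDenCT L M β μ 0 K ks.1)) *
          κ ks ≠ 0) :
    ContDiffOn ℝ n (fun Λ : ℝ =>
      ((hubbardCutoffWeightCT L M β μ K Λ ks.1 : ℂ) - (hubbardCutoffWeightCT L M β μ K Λ₀ ks.1 : ℂ)) *
          (((β * (L : ℝ) ^ 2 : ℝ) : ℂ) * ((Complex.I * matsubaraFreq β M ks.1.1 + nambuXiCT L μ K ks.1.2) / nambuDenCT L M β μ 0 K ks.1)) /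
        (1 + ((hubbardCutoffWeightCT L M β μ K Λ ks.1 : ℂ) - (hubbardCutoffWeightCT L M β μ K Λ₀ ks.1 : ℂ)) *
          (((β * (L : ℝ) ^ 2 : ℝ) : ℂ) * ((Complex.I * matsubaraFreq β M ks.1.1 + nambuXiCT L μ K ks.1.2) / nambuDenCT L M β μ 0 K ks.1)) *
          κ ks)) S := by
  have hs : ContDiffOn ℝ n (fun Λ : ℝ =>
      ((hubbardCutoffWeightCT L M β μ K Λ ks.1 : ℂ) - (hubbardCutoffWeightCT L M β μ K Λ₀ ks.1 : ℂ)) *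
        (((β * (L : ℝ) ^ 2 : ℝ) : ℂ) * ((Complex.I * matsubaraFreq β M ks.1.1 + nambuXiCT L μ K ks.1.2) / nambuDenCT L M β μ 0 K ks.1))) S :=
    (klws_contDiffOn_sliceSymbol L M β μ K (n := n) Λ₀ ks).mono hS0
  have hd : ContDiffOn ℝ n (fun Λ : ℝ =>
      (1 + ((hubbardCutoffWeightCT L M β μ K Λ ks.1 : ℂ) - (hubbardCutoffWeightCT L M β μ K Λ₀ ks.1 : ℂ)) *
          (((β * (L : ℝ) ^ 2 : ℝ) : ℂ) * ((Complex.I * matsubaraFreq β M ks.1.1 + nambuXiCT L μ K ks.1.2) / nambuDenCT L M β μ 0 K ks.1)) *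
          κ ks)⁻¹) S :=
    (contDiffOn_const.add (hs.mul contDiffOn_const)).inv hden
  exact (hs.mul hd).congr fun Λ _ => by simp only [div_eq_mul_inv]

/-- **The admissible scale set of the dressed family is open**: `U = {Λ ≠ 0 ∧ ∀ (k,σ), 1 + s_Λ(k,σ)κ(k,σ) ≠ 0}`. -/
theorem klws_isOpen_dressedScaleSet (Λ₀ : ℝ) (κ : FreqMomentum L M × Fin 2 → ℂ) :
    IsOpen {Λ : ℝ | Λ ≠ 0 ∧ ∀ ks : FreqMomentum L M × Fin 2,
      1 + ((hubbardCutoffWeightCT L M β μ K Λ ks.1 : ℂ) - (hubbardCutoffWeightCT L M β μ K Λ₀ ks.1 : ℂ)) *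
          (((β * (L : ℝ) ^ 2 : ℝ) : ℂ) * ((Complex.I * matsubaraFreq β M ks.1.1 + nambuXiCT L μ K ks.1.2) / nambuDenCT L M β μ 0 K ks.1)) *
          κ ks ≠ 0} := by
  have hrepr : {Λ : ℝ | Λ ≠ 0 ∧ ∀ ks : FreqMomentum L M × Fin 2,
      1 + ((hubbardCutoffWeightCT L M β μ K Λ ks.1 : ℂ) - (hubbardCutoffWeightCT L M β μ K Λ₀ ks.1 : ℂ)) *
          (((β * (L : ℝ) ^ 2 : ℝ) : ℂ) * ((Complex.I * matsubaraFreq β M ks.1.1 + nambuXiCT L μ K ks.1.2) / nambuDenCT L M β μ 0 K ks.1)) *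
          κ ks ≠ 0} =
      {Λ : ℝ | Λ ≠ 0} ∩ ⋂ ks : FreqMomentum L M × Fin 2, ({Λ : ℝ | Λ ≠ 0} ∩ (fun Λ : ℝ =>
        1 + ((hubbardCutoffWeightCT L M β μ K Λ ks.1 : ℂ) - (hubbardCutoffWeightCT L M β μ K Λ₀ ks.1 : ℂ)) *
          (((β * (L : ℝ) ^ 2 : ℝ) : ℂ) * ((Complex.I * matsubaraFreq β M ks.1.1 + nambuXiCT L μ K ks.1.2) / nambuDenCT L M β μ 0 K ks.1)) *
          κ ks) ⁻¹' {0}ᶜ) := by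
    ext Λ
    simp only [mem_setOf_eq, mem_iInter, mem_inter_iff, Set.mem_preimage, mem_compl_iff, mem_singleton_iff]
    exact ⟨fun h => ⟨h.1, fun ks => ⟨h.1, h.2 ks⟩⟩, fun h => ⟨h.1, fun ks => (h.2 ks).2⟩⟩
  rw [hrepr]
  refine isOpen_ne.inter (isOpen_iInter_of_finite fun ks => ?_)
  have hcont : ContinuousOn (fun Λ : ℝ =>
      1 + ((hubbardCutoffWeightCT L M β μ K Λ ks.1 : ℂ) - (hubbardCutoffWeightCT L M β μ K Λ₀ ks.1 : ℂ)) *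
          (((β * (L : ℝ) ^ 2 : ℝ) : ℂ) * ((Complex.I * matsubaraFreq β M ks.1.1 + nambuXiCT L μ K ks.1.2) / nambuDenCT L M β μ 0 K ks.1)) *
          κ ks) {Λ : ℝ | Λ ≠ 0} :=
    continuousOn_const.add (((klws_contDiffOn_sliceSymbol L M β μ K (n := 0) Λ₀ ks).continuousOn).mul continuousOn_const)
  exact hcont.isOpen_inter_preimage isOpen_ne isOpen_compl_singleton

omit [NeZero L] in
/-- **Every entry of the dressed partial-slice family is smooth on `U`.** -/
theorem klws_contDiffOn_dressedSliceCov_apply {n : ℕ∞} (Λ₀ : ℝ) (κ : FreqMomentum L M × Fin 2 → ℂ) (X Y : HubbardFieldIdx L M) :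
    ContDiffOn ℝ n (fun Λ : ℝ => normalCovariance L M (fun ks =>
        ((hubbardCutoffWeightCT L M β μ K Λ ks.1 : ℂ) - (hubbardCutoffWeightCT L M β μ K Λ₀ ks.1 : ℂ)) *
            (((β * (L : ℝ) ^ 2 : ℝ) : ℂ) * ((Complex.I * matsubaraFreq β M ks.1.1 + nambuXiCT L μ K ks.1.2) / nambuDenCT L M β μ 0 K ks.1)) /
          (1 + ((hubbardCutoffWeightCT L M β μ K Λ ks.1 : ℂ) - (hubbardCutoffWeightCT L M β μ K Λ₀ ks.1 : ℂ)) *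
            (((β * (L : ℝ) ^ 2 : ℝ) : ℂ) * ((Complex.I * matsubaraFreq β M ks.1.1 + nambuXiCT L μ K ks.1.2) / nambuDenCT L M β μ 0 K ks.1)) *
            κ ks)) X Y)
      {Λ : ℝ | Λ ≠ 0 ∧ ∀ ks : FreqMomentum L M × Fin 2,
        1 + ((hubbardCutoffWeightCT L M β μ K Λ ks.1 : ℂ) - (hubbardCutoffWeightCT L M β μ K Λ₀ ks.1 : ℂ)) *
            (((β * (L : ℝ) ^ 2 : ℝ) : ℂ) * ((Complex.I * matsubaraFreq β M ks.1.1 + nambuXiCT L μ K ks.1.2) / nambuDenCT L M β μ 0 K ks.1)) *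
            κ ks ≠ 0} := by
  have hd : ∀ ks, ContDiffOn ℝ n (fun Λ : ℝ =>
      ((hubbardCutoffWeightCT L M β μ K Λ ks.1 : ℂ) - (hubbardCutoffWeightCT L M β μ K Λ₀ ks.1 : ℂ)) *
            (((β * (L : ℝ) ^ 2 : ℝ) : ℂ) * ((Complex.I * matsubaraFreq β M ks.1.1 + nambuXiCT L μ K ks.1.2) / nambuDenCT L M β μ 0 K ks.1)) /
          (1 + ((hubbardCutoffWeightCT L M β μ K Λ ks.1 : ℂ) - (hubbardCutoffWeightCT L M β μ K Λ₀ ks.1 : ℂ)) *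
            (((β * (L : ℝ) ^ 2 : ℝ) : ℂ) * ((Complex.I * matsubaraFreq β M ks.1.1 + nambuXiCT L μ K ks.1.2) / nambuDenCT L M β μ 0 K ks.1)) *
            κ ks))
      {Λ : ℝ | Λ ≠ 0 ∧ ∀ ks : FreqMomentum L M × Fin 2,
        1 + ((hubbardCutoffWeightCT L M β μ K Λ ks.1 : ℂ) - (hubbardCutoffWeightCT L M β μ K Λ₀ ks.1 : ℂ)) *
            (((β * (L : ℝ) ^ 2 : ℝ) : ℂ) * ((Complex.I * matsubaraFreq β M ks.1.1 + nambuXiCT L μ K ks.1.2) / nambuDenCT L M β μ 0 K ks.1)) *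
            κ ks ≠ 0} :=
    fun ks => klws_contDiffOn_dressedSymbol L M β μ K (n := n) Λ₀ κ ks (fun Λ hΛ => hΛ.1) (fun Λ hΛ => hΛ.2 ks)
  simp only [normalCovariance_apply]
  by_cases h1 : X.1 = Y.1
  · simp only [if_pos h1]
    by_cases h2 : X.2 = 0 ∧ Y.2 = 1
    · simp only [if_pos h2]; exact hd X.1
    · simp only [if_neg h2]
      by_cases h3 : X.2 = 1 ∧ Y.2 = 0
      · simp only [if_pos h3]; exact (hd X.1).neg
      · simp only [if_neg h3]; exact contDiffOn_const
  · simp only [if_neg h1]; exact contDiffOn_const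

/-- **First-derivative data on `U`**: at every `Λ ∈ U`, each entry of the dressed family has derivative `deriv (…) Λ` (the `hC` hypothesis of
`klws_pairKernel_flowData_of_covCurve`, in `deriv` form; its closed form is `klws_hasDerivAt_dressedSliceCov`). -/
theorem klws_hasDerivAt_dressedSliceCov_of_mem (Λ₀ : ℝ) (κ : FreqMomentum L M × Fin 2 → ℂ) (X Y : HubbardFieldIdx L M) {Λ : ℝ}
    (hΛ : Λ ∈ {Λ : ℝ | Λ ≠ 0 ∧ ∀ ks : FreqMomentum L M × Fin 2,
        1 + ((hubbardCutoffWeightCT L M β μ K Λ ks.1 : ℂ) - (hubbardCutoffWeightCT L M β μ K Λ₀ ks.1 : ℂ)) *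
            (((β * (L : ℝ) ^ 2 : ℝ) : ℂ) * ((Complex.I * matsubaraFreq β M ks.1.1 + nambuXiCT L μ K ks.1.2) / nambuDenCT L M β μ 0 K ks.1)) *
            κ ks ≠ 0}) :
    HasDerivAt (fun Λ' : ℝ => normalCovariance L M (fun ks =>
        ((hubbardCutoffWeightCT L M β μ K Λ' ks.1 : ℂ) - (hubbardCutoffWeightCT L M β μ K Λ₀ ks.1 : ℂ)) *
            (((β * (L : ℝ) ^ 2 : ℝ) : ℂ) * ((Complex.I * matsubaraFreq β M ks.1.1 + nambuXiCT L μ K ks.1.2) / nambuDenCT L M β μ 0 K ks.1)) /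
          (1 + ((hubbardCutoffWeightCT L M β μ K Λ' ks.1 : ℂ) - (hubbardCutoffWeightCT L M β μ K Λ₀ ks.1 : ℂ)) *
            (((β * (L : ℝ) ^ 2 : ℝ) : ℂ) * ((Complex.I * matsubaraFreq β M ks.1.1 + nambuXiCT L μ K ks.1.2) / nambuDenCT L M β μ 0 K ks.1)) *
            κ ks)) X Y)
      (deriv (fun Λ' : ℝ => normalCovariance L M (fun ks =>
        ((hubbardCutoffWeightCT L M β μ K Λ' ks.1 : ℂ) - (hubbardCutoffWeightCT L M β μ K Λ₀ ks.1 : ℂ)) *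
            (((β * (L : ℝ) ^ 2 : ℝ) : ℂ) * ((Complex.I * matsubaraFreq β M ks.1.1 + nambuXiCT L μ K ks.1.2) / nambuDenCT L M β μ 0 K ks.1)) /
          (1 + ((hubbardCutoffWeightCT L M β μ K Λ' ks.1 : ℂ) - (hubbardCutoffWeightCT L M β μ K Λ₀ ks.1 : ℂ)) *
            (((β * (L : ℝ) ^ 2 : ℝ) : ℂ) * ((Complex.I * matsubaraFreq β M ks.1.1 + nambuXiCT L μ K ks.1.2) / nambuDenCT L M β μ 0 K ks.1)) *
            κ ks)) X Y) Λ) Λ := by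
  have h1 := klws_contDiffOn_dressedSliceCov_apply L M β μ K (n := 1) Λ₀ κ X Y
  exact ((h1.differentiableOn one_ne_zero).differentiableAt
    ((klws_isOpen_dressedScaleSet L M β μ K Λ₀ κ).mem_nhds hΛ)).hasDerivAt

/-- **Second-derivative data on `U`**: at every `Λ ∈ U`, the `deriv` of each entry of the dressed family has derivative `deriv (deriv …) Λ` (the `hC'`
hypothesis of `klws_pairKernel_flowData_of_covCurve`: the dressed curve is `C²`). -/
theorem klws_hasDerivAt_deriv_dressedSliceCov_of_mem (Λ₀ : ℝ) (κ : FreqMomentum L M × Fin 2 → ℂ) (X Y : HubbardFieldIdx L M) {Λ : ℝ}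
    (hΛ : Λ ∈ {Λ : ℝ | Λ ≠ 0 ∧ ∀ ks : FreqMomentum L M × Fin 2,
        1 + ((hubbardCutoffWeightCT L M β μ K Λ ks.1 : ℂ) - (hubbardCutoffWeightCT L M β μ K Λ₀ ks.1 : ℂ)) *
            (((β * (L : ℝ) ^ 2 : ℝ) : ℂ) * ((Complex.I * matsubaraFreq β M ks.1.1 + nambuXiCT L μ K ks.1.2) / nambuDenCT L M β μ 0 K ks.1)) *
            κ ks ≠ 0}) :
    HasDerivAt (fun Λ' : ℝ => deriv (fun Λ'' : ℝ => normalCovariance L M (fun ks =>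
        ((hubbardCutoffWeightCT L M β μ K Λ'' ks.1 : ℂ) - (hubbardCutoffWeightCT L M β μ K Λ₀ ks.1 : ℂ)) *
            (((β * (L : ℝ) ^ 2 : ℝ) : ℂ) * ((Complex.I * matsubaraFreq β M ks.1.1 + nambuXiCT L μ K ks.1.2) / nambuDenCT L M β μ 0 K ks.1)) /
          (1 + ((hubbardCutoffWeightCT L M β μ K Λ'' ks.1 : ℂ) - (hubbardCutoffWeightCT L M β μ K Λ₀ ks.1 : ℂ)) *
            (((β * (L : ℝ) ^ 2 : ℝ) : ℂ) * ((Complex.I * matsubaraFreq β M ks.1.1 + nambuXiCT L μ K ks.1.2) / nambuDenCT L M β μ 0 K ks.1)) *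
            κ ks)) X Y) Λ')
      (deriv (deriv (fun Λ'' : ℝ => normalCovariance L M (fun ks =>
        ((hubbardCutoffWeightCT L M β μ K Λ'' ks.1 : ℂ) - (hubbardCutoffWeightCT L M β μ K Λ₀ ks.1 : ℂ)) *
            (((β * (L : ℝ) ^ 2 : ℝ) : ℂ) * ((Complex.I * matsubaraFreq β M ks.1.1 + nambuXiCT L μ K ks.1.2) / nambuDenCT L M β μ 0 K ks.1)) /
          (1 + ((hubbardCutoffWeightCT L M β μ K Λ'' ks.1 : ℂ) - (hubbardCutoffWeightCT L M β μ K Λ₀ ks.1 : ℂ)) *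
            (((β * (L : ℝ) ^ 2 : ℝ) : ℂ) * ((Complex.I * matsubaraFreq β M ks.1.1 + nambuXiCT L μ K ks.1.2) / nambuDenCT L M β μ 0 K ks.1)) *
            κ ks)) X Y)) Λ) Λ := by
  have hU := klws_isOpen_dressedScaleSet L M β μ K Λ₀ κ
  have h2 := klws_contDiffOn_dressedSliceCov_apply L M β μ K (n := 2) Λ₀ κ X Y
  have h1 : ContDiffOn ℝ 1 (deriv fun Λ'' : ℝ => normalCovariance L M (fun ks =>
        ((hubbardCutoffWeightCT L M β μ K Λ'' ks.1 : ℂ) - (hubbardCutoffWeightCT L M β μ K Λ₀ ks.1 : ℂ)) *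
            (((β * (L : ℝ) ^ 2 : ℝ) : ℂ) * ((Complex.I * matsubaraFreq β M ks.1.1 + nambuXiCT L μ K ks.1.2) / nambuDenCT L M β μ 0 K ks.1)) /
          (1 + ((hubbardCutoffWeightCT L M β μ K Λ'' ks.1 : ℂ) - (hubbardCutoffWeightCT L M β μ K Λ₀ ks.1 : ℂ)) *
            (((β * (L : ℝ) ^ 2 : ℝ) : ℂ) * ((Complex.I * matsubaraFreq β M ks.1.1 + nambuXiCT L μ K ks.1.2) / nambuDenCT L M β μ 0 K ks.1)) *
            κ ks)) X Y) _ :=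
    h2.deriv_of_isOpen hU (by norm_num)
  exact ((h1.differentiableOn one_ne_zero).differentiableAt (hU.mem_nhds hΛ)).hasDerivAt

end Model

end Summit.HubbardSuperconductivity.HubbardSuperconductivity.Theorems.KLRegimeWick

end
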